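import Mathlib
import HarnessLib
import Literature.AlgebraicGeometry.Resolution.CobordantBlowupAffineSpace
import Summits.ResolutionOfSingularities.ResolutionOfSingularities.Theorems.WildQuotientsWildQuotientResolutionS1aCoarseChart

/-!
# S1a — K-FREE FRAME, (F-T8) models: transport of the COBORDANT ALGEBRA along a ring isomorphism, weight-0 absorption, and the chart ring as a localisation of a model

[OURS · L1 W4.5c · lead-1 g12; plan-1 A-KF v1 §2.4 «explicit presentation of B′ = R^w(B)[(y_jT^{d̄})⁻¹]», R-F15b (6), R-F15c (I-2 := MT-a1″)] — NOT statements of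
the manuscript; counted 0; AI-level work, weaker than expert review. Crux stmt-ResolutionOfSingularities-17941 `CyclicQuotientFourfolds`, line `s1a-logminvertex`
(`stub_reachLowerInFX`). Pure algebra.

The instance datum is an ABSTRACT ring `A ≃ k[x]` (`e`); Włodarczyk's model `k[x₀, x′] ≅ R^w(k[x])` (Literature `cobordantAlgebra.affineSpaceEquiv`, Example 2.3.3)
lives over `k[x]` with ALL coordinates in the centre (weight 0 allowed). This file bridges the two:
* `mapT e` (`= e ⊗ id_T` on Laurent polynomials), `mapT_C_mul_T`; ★ `cobordantAlgebra.congr e u w : cobordantAlgebra u w ≃+* cobordantAlgebra (e ∘ u) w`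
  (`Algebra.adjoin` generators go to generators) with pins `congr_s`, `congr_u'`, `congr_algebraMap`, `coe_congr`;
* `cobordantAlgebra_le_of_mem`, ★ `cobordantAlgebra_eq_of_weight_zero` — adjoining further centre generators OF WEIGHT 0 does not change `R^w`
  (they are constants): `cobordantAlgebra (Fin.append u v) (Fin.append w 0) = cobordantAlgebra u w` in the form needed (generator-wise statement);
* ★ `chartRingEquivAway` — `ChartRing 𝒜 f w d b hb ≃+* Localization.Away (Ψ (coverElement b)) P` for any ring iso `Ψ : R^w ≃+* P` onto a model ring
  (`IsLocalization.ringEquivOfRingEquiv`), with the pin `chartRingEquivAway_algebraMap`.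
-/

set_option linter.dupNamespace false

noncomputable section

open Literature.AlgebraicGeometry.Resolution
open scoped LaurentPolynomial

namespace Summit.ResolutionOfSingularities.ResolutionOfSingularities.Theorems.WildQuotientResolution.S1.CobordantTransport

universe u

/-! ## `e ⊗ id_T` and the transport of `R^w` -/

section MapT

variable {A A' : Type u} [CommRing A] [CommRing A'] (e : A ≃+* A')

/-- `e ⊗ id_T` on Laurent polynomials (coefficientwise `e`). -/
def mapT : A[T;T⁻¹] ≃+* A'[T;T⁻¹] :=
  AddMonoidAlgebra.mapRingEquiv ℤ e

/-- Coefficients of `mapT e x`. -/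
@[simp] theorem coeff_mapT (x : A[T;T⁻¹]) (m : ℤ) : (mapT e x).coeff m = e (x.coeff m) :=
  AddMonoidAlgebra.coeff_mapRingEquiv e x m

/-- `mapT e (C a · Tⁿ) = C (e a) · Tⁿ`. -/
theorem mapT_C_mul_T (a : A) (n : ℤ) : mapT e (LaurentPolynomial.C a * LaurentPolynomial.T n) = LaurentPolynomial.C (e a) * LaurentPolynomial.T n := by
  rw [mapT, ← LaurentPolynomial.single_eq_C_mul_T, ← LaurentPolynomial.single_eq_C_mul_T]
  exact AddMonoidAlgebra.mapRingEquiv_single e a n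

/-- `mapT e (C a) = C (e a)`. -/
theorem mapT_C (a : A) : mapT e (LaurentPolynomial.C a) = LaurentPolynomial.C (e a) := by
  have := mapT_C_mul_T e a 0
  simp only [LaurentPolynomial.T_zero, mul_one] at this
  exact this

/-- `mapT e (Tⁿ) = Tⁿ`. -/
theorem mapT_T (n : ℤ) : mapT e (LaurentPolynomial.T n : A[T;T⁻¹]) = LaurentPolynomial.T n := by
  have := mapT_C_mul_T e 1 n
  simp only [map_one, one_mul] at this
  exact this

/-- The inverse of `mapT e` is `mapT e⁻¹`. -/
theorem mapT_symm_apply (x : A'[T;T⁻¹]) : (mapT e).symm x = mapT e.symm x := rfl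

variable {ι : Type*} (u : ι → A) (w : ι → ℕ)

/-- `mapT e` maps `R^w(u, w)` into `R^w(e ∘ u, w)`. -/
theorem mapT_mem {x : A[T;T⁻¹]} (hx : x ∈ cobordantAlgebra u w) : mapT e x ∈ cobordantAlgebra (⇑e ∘ u) w := by
  induction hx using Algebra.adjoin_induction with
  | mem x hx =>
    rcases hx with rfl | ⟨i, rfl⟩
    · rw [mapT_T]; exact cobordantAlgebra.T_neg_one_mem _ _
    · rw [mapT_C_mul_T]; exact cobordantAlgebra.C_mul_T_mem (⇑e ∘ u) w i
  | algebraMap a =>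
    change mapT e (LaurentPolynomial.C a) ∈ _
    rw [mapT_C]
    exact Subalgebra.algebraMap_mem _ (e a)
  | add x y _ _ hx hy => rw [map_add]; exact add_mem hx hy
  | mul x y _ _ hx hy => rw [map_mul]; exact mul_mem hx hy

/-- ★ **Transport of the cobordant algebra along a ring isomorphism of the base**: `R^w(u, w) ≃ R^w(e ∘ u, w)`. [OURS · L1 W4.5c] -/
def congr : ↥(cobordantAlgebra u w) ≃+* ↥(cobordantAlgebra (⇑e ∘ u) w) where
  toFun x := ⟨mapT e x, mapT_mem e u w x.2⟩
  invFun y := ⟨mapT e.symm y, by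
    have h := mapT_mem e.symm (⇑e ∘ u) w y.2
    have hcomp : (⇑e.symm ∘ (⇑e ∘ u)) = u := funext fun i => e.symm_apply_apply (u i)
    rwa [hcomp] at h⟩
  left_inv x := Subtype.ext (by
    change mapT e.symm (mapT e x) = x
    rw [← mapT_symm_apply]; exact (mapT e).symm_apply_apply _)
  right_inv y := Subtype.ext (by
    change mapT e (mapT e.symm y) = y
    rw [← mapT_symm_apply]; exact (mapT e).apply_symm_apply _)
  map_mul' x y := Subtype.ext (map_mul (mapT e) (x : A[T;T⁻¹]) (y : A[T;T⁻¹]))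
  map_add' x y := Subtype.ext (map_add (mapT e) (x : A[T;T⁻¹]) (y : A[T;T⁻¹]))

/-- Underlying Laurent polynomial of `congr e u w x`. -/
@[simp] theorem coe_congr (x : ↥(cobordantAlgebra u w)) : ((congr e u w x : ↥(cobordantAlgebra (⇑e ∘ u) w)) : A'[T;T⁻¹]) = mapT e x := rfl

/-- Pin: `s ↦ s`. -/
theorem congr_s : congr e u w (cobordantAlgebra.s u w) = cobordantAlgebra.s (⇑e ∘ u) w :=
  Subtype.ext (by rw [coe_congr, cobordantAlgebra.coe_s, cobordantAlgebra.coe_s, mapT_T])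

/-- Pin: `uᵢ' ↦ uᵢ'`. -/
theorem congr_u' (i : ι) : congr e u w (cobordantAlgebra.u' u w i) = cobordantAlgebra.u' (⇑e ∘ u) w i :=
  Subtype.ext (by rw [coe_congr, cobordantAlgebra.coe_u', cobordantAlgebra.coe_u', mapT_C_mul_T]; rfl)

/-- Pin: constants `a ↦ e a`. -/
theorem congr_algebraMap (a : A) : congr e u w (algebraMap A _ a) = algebraMap A' _ (e a) :=
  Subtype.ext (by rw [coe_congr, cobordantAlgebra.coe_algebraMap, cobordantAlgebra.coe_algebraMap, mapT_C])

/-- Pin: a monomial `⟨C a · Tⁿ, _⟩ ↦ ⟨C (e a) · Tⁿ, _⟩` (on underlying Laurent polynomials). -/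
theorem coe_congr_mk {a : A} {n : ℤ} (h : LaurentPolynomial.C a * LaurentPolynomial.T n ∈ cobordantAlgebra u w) :
    ((congr e u w ⟨_, h⟩ : ↥(cobordantAlgebra (⇑e ∘ u) w)) : A'[T;T⁻¹]) = LaurentPolynomial.C (e a) * LaurentPolynomial.T n := by
  rw [coe_congr, mapT_C_mul_T]

end MapT

/-! ## Weight-0 generators do not change `R^w` -/

section WeightZero

variable {A : Type u} [CommRing A]

/-- `R^w(u, w)` is contained in any subalgebra containing `T⁻¹` and the `C(uᵢ)T^{wᵢ}`. -/
theorem cobordantAlgebra_le_of_mem {ι : Type*} (u : ι → A) (w : ι → ℕ) (S : Subalgebra A A[T;T⁻¹])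
    (hs : (LaurentPolynomial.T (-1) : A[T;T⁻¹]) ∈ S) (hu : ∀ i, LaurentPolynomial.C (u i) * LaurentPolynomial.T (w i : ℤ) ∈ S) :
    cobordantAlgebra u w ≤ S := by
  refine Algebra.adjoin_le ?_
  rintro _ (rfl | ⟨i, rfl⟩)
  · exact hs
  · exact hu i

/-- A generator of weight `0` is a constant, hence in every `R^w`. -/
theorem C_mul_T_zero_mem {ι : Type*} (u : ι → A) (w : ι → ℕ) (a : A) :
    LaurentPolynomial.C a * LaurentPolynomial.T ((0 : ℕ) : ℤ) ∈ cobordantAlgebra u w := by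
  rw [Nat.cast_zero, LaurentPolynomial.T_zero, mul_one]
  exact Subalgebra.algebraMap_mem (cobordantAlgebra u w) a

/-- ★ **Weight-0 absorption**: two centre presentations whose POSITIVE-weight generators agree (as sets of monomials `C(uᵢ)T^{wᵢ}`) and which otherwise differ by
weight-0 generators have the same cobordant algebra. Generator-wise form: if every generator of each side is a generator of the other side or has weight 0,
the algebras coincide. [OURS · L1 W4.5c] -/
theorem cobordantAlgebra_eq_of_generators {ι κ : Type*} (u : ι → A) (w : ι → ℕ) (v : κ → A) (w' : κ → ℕ)
    (h₁ : ∀ i, w i = 0 ∨ ∃ j, v j = u i ∧ w' j = w i) (h₂ : ∀ j, w' j = 0 ∨ ∃ i, u i = v j ∧ w i = w' j) :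
    cobordantAlgebra u w = cobordantAlgebra v w' := by
  apply le_antisymm
  · refine cobordantAlgebra_le_of_mem u w _ (cobordantAlgebra.T_neg_one_mem v w') fun i => ?_
    rcases h₁ i with h | ⟨j, hj, hw⟩
    · rw [h]; exact C_mul_T_zero_mem v w' (u i)
    · rw [← hj, ← hw]; exact cobordantAlgebra.C_mul_T_mem v w' j
  · refine cobordantAlgebra_le_of_mem v w' _ (cobordantAlgebra.T_neg_one_mem u w) fun j => ?_
    rcases h₂ j with h | ⟨i, hi, hw⟩
    · rw [h]; exact C_mul_T_zero_mem u w (v j)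
    · rw [← hi, ← hw]; exact cobordantAlgebra.C_mul_T_mem u w i

end WeightZero

/-! ## The chart ring as a localisation of a model -/

section Away

open CoarseChart

variable {ι : Type*} [AddCommGroup ι] [DecidableEq ι] {B : Type u} [CommRing B] (𝒜 : ι → AddSubgroup B) [GradedRing 𝒜] {c : ℕ}
  (f : Fin c → B) (w : Fin c → ℕ) (d : ℕ) (b : ↥(𝒜 0)) (hb : b ∈ (traceFiltration 𝒜 f w).ideal d)
  {P : Type u} [CommRing P] (Ψ : ↥(cobordantAlgebra f w) ≃+* P)

/-- ★ **The chart ring is the localisation of any model of `R^w` at the image of the cover element.** [OURS · L1 W4.5c · (F-T8) models] -/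
def chartRingEquivAway : ChartRing 𝒜 f w d b hb ≃+* Localization.Away (Ψ (coverElement 𝒜 f w d b hb)) :=
  IsLocalization.ringEquivOfRingEquiv (M := Submonoid.powers (coverElement 𝒜 f w d b hb)) (T := Submonoid.powers (Ψ (coverElement 𝒜 f w d b hb)))
    (ChartRing 𝒜 f w d b hb) (Localization.Away (Ψ (coverElement 𝒜 f w d b hb))) Ψ (by
      rw [Submonoid.map_powers]; rfl)

/-- Pin: the structure maps commute with the model isomorphism. -/
theorem chartRingEquivAway_algebraMap (z : ↥(cobordantAlgebra f w)) :
    chartRingEquivAway 𝒜 f w d b hb Ψ (algebraMap _ (ChartRing 𝒜 f w d b hb) z) = algebraMap P (Localization.Away (Ψ (coverElement 𝒜 f w d b hb))) (Ψ z) :=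
  IsLocalization.ringEquivOfRingEquiv_eq _ z

/-- Pin: `toChartRing x ↦ algebraMap (Ψ (C x))`. -/
theorem chartRingEquivAway_toChartRing (x : ↥(𝒜 0)) :
    chartRingEquivAway 𝒜 f w d b hb Ψ (toChartRing 𝒜 f w d b hb x) =
      algebraMap P (Localization.Away (Ψ (coverElement 𝒜 f w d b hb))) (Ψ (algebraMap B _ (x : B))) :=
  chartRingEquivAway_algebraMap 𝒜 f w d b hb Ψ _

end Away

end Summit.ResolutionOfSingularities.ResolutionOfSingularities.Theorems.WildQuotientResolution.S1.CobordantTransport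

end
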